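import Summits.CriticalPhenomena.PercolationContinuityZ3.Theorems.PercNearOneGluingNoHeavyLowerTailSahiTransportJRDict

/-!
# `NoHeavyLowerTail` (crux stmt-CriticalPhenomena-4575), Sahi / Kahn positivity: parameter-free transport certificates — SOUNDNESS (II), the scaled measure

Support file (cell `prim-l12`, seat P3, gen 5; `--supports stmt-CriticalPhenomena-4575`).  No `sorry`, no named facts, standard axioms.
Part of the SOUNDNESS of the parameter-free transport-certificate check `SahiTransportJR.checkTab` (`…SahiTransportJRTables`): if the digit test of
every capacity row and every (TC) row of a coefficient table `ct` for the pattern event with bitmask `M` passes, then at EVERY parameter vector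
`q ∈ [0,1]^m` the scaled measure `σ_q(T) = (1/DEN)·Σ_{η ∉ H ∋ ζ} ct[η][ζ][code T]·w_q(η)w_q(ζ)` satisfies (o), (a), (TC) of the reduced certificate,
hence (Strassen) a `SahiTransportCert.TransportCert` exists and Kahn's Conjecture 5 / Sahi's `C₃` holds for that junta first slot with the other
two slots arbitrary (`…SahiTransportCert.sahiE_three_nonneg_of_transportCert`).  Chain: `…JRDict` (dictionary `Set (Fin m)` ↔ bitmasks for
general `m`, structural facts of a table) → `…JRMeasure` (the scaled measure: mass, support, the stochastic-order condition (o)) → `…JRRows`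
(capacity and (TC) rows: certificate numbers = `cubicZ` of explicit term families, digit test ⇒ row inequality) → `…JRSound` (the certificate and
`sahiE_three_nonneg_of_checkTab`). [this work]

This file: the digit test for an explicit term family indexed by any finite type (`cubicForm_nonneg_of_rowOK`, the argument of
`SahiTransportCheck.checkVec_sound`); the scaled transport measure `sg` of a table, its pairing with events (`sum_sg_mul_ind`), sign, support,
total mass `w(Hᶜ)·w(H)` (`sum_sg`), the bounds `0 ≤ massK ≤ DEN`, and the stochastic-order condition (o) (`stoch_of_tabFacts`).
-/

noncomputable section

open scoped Classical

namespace Summit.CriticalPhenomena.PercolationContinuityZ3.Theorems.SahiTransportJR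

open Finset SahiHittingSlot SahiTransportCert SahiC3Cube SahiTransportCheck OneCutCert CovTransferCert Literature.Combinatorics.Sahi2008
open Literature.Probability.Percolation (DeterminedBy)
open Literature.Probability.Percolation.BHK2006 (weight ind_inter)
open Literature.Probability.Percolation.DecisionTree (ind ind_of_mem ind_of_not_mem ind_nonneg)

variable {m : ℕ}

/-! ### Part B: the digit test for an explicit term family; the scaled transport measure of a table -/

/-- **Digit test ⇒ nonnegativity** for a signed family of cubic bitmask terms indexed by a finite type (the argument of
`SahiTransportCheck.checkVec_sound`, restated for an arbitrary index type and a precomputed certificate number). [this work] -/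
theorem cubicForm_nonneg_of_rowOK {J : Type*} [Fintype J] {σ : ℕ} (s : J → ℤ) (T₁ T₂ T₃ : J → ℕ) (hσ : 0 < σ)
    (hB : (∑ j, |s j|) * 8 ^ m < 2 ^ (σ - 1))
    (hrow : rowOK (offT σ m) (offT σ m).toNat
      (cubicZ (2 ^ σ) s (fun j => tabZ m (T₁ j)) (fun j => tabZ m (T₂ j)) (fun j => tabZ m (T₃ j))) = true)
    {x : Fin m → ℝ} (hx : InCube x) :
    0 ≤ cubicForm s (fun j => tabZ m (T₁ j)) (fun j => tabZ m (T₂ j)) (fun j => tabZ m (T₃ j)) x := by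
  unfold rowOK at hrow
  simp only [Bool.and_eq_true, decide_eq_true_eq] at hrow
  obtain ⟨hZ, hland⟩ := hrow
  set X : J → (Fin m → Bool) → ℤ := fun j => tabZ m (T₁ j) with hXd
  set Y : J → (Fin m → Bool) → ℤ := fun j => tabZ m (T₂ j) with hYd
  set W : J → (Fin m → Bool) → ℤ := fun j => tabZ m (T₃ j) with hWd
  have hoff : offT σ m = (maskN σ (4 ^ m) : ℤ) := by
    unfold offT
    rw [off_eq σ (4 ^ m) hσ, maskN_eq_sum σ hσ, Finset.mul_sum]
  rw [hoff] at hZ hland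
  rw [Int.toNat_natCast] at hland
  have hBnd : CoefBound3 s X Y W (2 ^ (σ - 1)) := by
    intro k
    have h8 : ∀ j, |s j * pcoef3 (X j) (Y j) (W j) k| ≤ |s j| * 8 ^ m := by
      intro j
      rw [abs_mul]
      exact mul_le_mul_of_nonneg_left (abs_pcoef3_le _ _ _ (fun g => abs_tabZ_le _ _ _) (fun g => abs_tabZ_le _ _ _)
        (fun g => abs_tabZ_le _ _ _) k) (abs_nonneg _)
    have hsum : |cubicCoef s X Y W k| ≤ (∑ j, |s j|) * 8 ^ m := by
      unfold cubicCoef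
      calc |∑ j, s j * pcoef3 (X j) (Y j) (W j) k|
          ≤ ∑ j, |s j * pcoef3 (X j) (Y j) (W j) k| := Finset.abs_sum_le_sum_abs _ _
        _ ≤ ∑ j, |s j| * (8 : ℤ) ^ m := Finset.sum_le_sum fun j _ => h8 j
        _ = (∑ j, |s j|) * 8 ^ m := by rw [Finset.sum_mul]
    exact lt_of_le_of_lt hsum hB
  set N : ℕ := (cubicZ (2 ^ σ) s X Y W + maskN σ (4 ^ m)).toNat with hN
  have hNZ : (N : ℤ) = cubicZ (2 ^ σ) s X Y W + ∑ j : Fin (4 ^ m), (2 : ℤ) ^ (σ - 1) * (2 ^ σ) ^ (j : ℕ) := by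
    rw [hN, Int.toNat_of_nonneg hZ, maskN_eq_sum σ hσ, Fin.sum_univ_eq_sum_range
      (fun j => (2 : ℤ) ^ (σ - 1) * (2 ^ σ) ^ j) (4 ^ m)]
  have hdig : ∀ j : ℕ, j < 4 ^ m → 2 ^ (σ - 1) ≤ digit (2 ^ σ) N j := digit_ge_of_land σ hσ (4 ^ m) N hland
  have hk : ∀ k, 0 ≤ cubicCoef s X Y W k := cubicCoef_nonneg_of_digit_ge hσ hBnd N hNZ hdig
  exact cubicForm_nonneg hk hx

/-! #### The scaled transport measure of a table -/

/-- The SCALED TRANSPORT MEASURE of a table: `σ(T) = (1/DEN)·Σ_{η ∉ H ∋ ζ} ct[η][ζ][code T]·w(η)·w(ζ)` (`= θδ·ρ(T)`). [this work] -/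
def sg (m M : ℕ) (ct : Tab) (q : Fin m → unitInterval) (T : Set (Fin m)) : ℝ :=
  (∑ η ∈ Finset.range (2 ^ m), ∑ ζ ∈ Finset.range (2 ^ m),
    if M.testBit η = false ∧ M.testBit ζ = true then (get3 ct η ζ (code T) : ℝ) * (mlM m (2 ^ η) (xq q) * mlM m (2 ^ ζ) (xq q)) else 0) / DEN

/-- `DEN > 0`. [this work] -/
theorem DEN_pos : (0 : ℝ) < DEN := by unfold DEN; norm_num

/-- The indicator of an event at a decoded point is the bit of its code mask. [this work] -/
theorem ind_pt_eq (𝒴 : Set (Set (Fin m))) {t : ℕ} (ht : t < 2 ^ m) :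
    ind 𝒴 (pt m t) = if (encA m 𝒴).testBit t = true then 1 else 0 := by
  rw [testBit_encA]
  by_cases h : pt m t ∈ 𝒴
  · rw [ind_of_mem h]; simp [h, ht]
  · rw [ind_of_not_mem h]; simp [h]

/-- **Pairing the scaled measure with an event**: `DEN·Σ_T σ(T)·1_𝒴(T) = Σ_{η ∉ H ∋ ζ} (Σ_{t : bit t of encA 𝒴} ct[η][ζ][t])·w(η)w(ζ)`. [this work] -/
theorem sum_sg_mul_ind (M : ℕ) (ct : Tab) (q : Fin m → unitInterval) (𝒴 : Set (Set (Fin m))) :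
    (DEN : ℝ) * ∑ T, sg m M ct q T * ind 𝒴 T =
      ∑ η ∈ Finset.range (2 ^ m), ∑ ζ ∈ Finset.range (2 ^ m),
        if M.testBit η = false ∧ M.testBit ζ = true then
          (∑ t ∈ Finset.range (2 ^ m), if (encA m 𝒴).testBit t = true then (get3 ct η ζ t : ℝ) else 0) *
            (mlM m (2 ^ η) (xq q) * mlM m (2 ^ ζ) (xq q)) else 0 := by
  rw [Finset.mul_sum]
  have h1 : ∀ T, (DEN : ℝ) * (sg m M ct q T * ind 𝒴 T) =
      ∑ η ∈ Finset.range (2 ^ m), ∑ ζ ∈ Finset.range (2 ^ m),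
        if M.testBit η = false ∧ M.testBit ζ = true then
          ((get3 ct η ζ (code T) : ℝ) * ind 𝒴 T) * (mlM m (2 ^ η) (xq q) * mlM m (2 ^ ζ) (xq q)) else 0 := by
    intro T
    unfold sg
    rw [div_mul_eq_mul_div, mul_div_cancel₀ _ DEN_pos.ne', Finset.sum_mul]
    refine Finset.sum_congr rfl fun η _ => ?_
    rw [Finset.sum_mul]
    refine Finset.sum_congr rfl fun ζ _ => ?_
    split_ifs <;> ring
  simp_rw [h1]
  rw [Finset.sum_comm]
  refine Finset.sum_congr rfl fun η _ => ?_
  rw [Finset.sum_comm]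
  refine Finset.sum_congr rfl fun ζ _ => ?_
  by_cases hc : M.testBit η = false ∧ M.testBit ζ = true
  · simp only [if_pos hc]
    rw [← Finset.sum_mul, sum_eq_sum_range (fun T => (get3 ct η ζ (code T) : ℝ) * ind 𝒴 T)]
    congr 1
    refine Finset.sum_congr rfl fun t ht => ?_
    rw [code_pt (Finset.mem_range.1 ht), ind_pt_eq 𝒴 (Finset.mem_range.1 ht)]
    split_ifs <;> simp
  · simp only [if_neg hc, Finset.sum_const_zero]

/-- The scaled measure is nonnegative (nonnegative table). [this work] -/
theorem sg_nonneg {M : ℕ} {ct : Tab} (hf : TabFacts m M ct) (q : Fin m → unitInterval) (T : Set (Fin m)) : 0 ≤ sg m M ct q T := by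
  unfold sg
  refine div_nonneg (Finset.sum_nonneg fun η hη => Finset.sum_nonneg fun ζ hζ => ?_) DEN_pos.le
  split_ifs with hc
  · exact mul_nonneg (by exact_mod_cast hf.nonneg η (Finset.mem_range.1 hη) hc.1 ζ (Finset.mem_range.1 hζ) hc.2 _ (code_lt T))
      (mul_nonneg (mlM_nonneg _ (inCube_xq q)) (mlM_nonneg _ (inCube_xq q)))
  · exact le_rfl

/-- The scaled measure vanishes off `H`. [this work] -/
theorem sg_eq_zero {M : ℕ} {ct : Tab} (hf : TabFacts m M ct) (q : Fin m → unitInterval) {T : Set (Fin m)}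
    (hT : M.testBit (code T) = false) : sg m M ct q T = 0 := by
  unfold sg
  rw [Finset.sum_eq_zero, zero_div]
  intro η hη
  refine Finset.sum_eq_zero fun ζ hζ => ?_
  split_ifs with hc
  · have : get3 ct η ζ (code T) = 0 := by
      by_contra hne
      have := (hf.supp η (Finset.mem_range.1 hη) hc.1 ζ (Finset.mem_range.1 hζ) hc.2 _ (code_lt T) hne).2
      rw [hT] at this; exact Bool.false_ne_true this
    rw [this]; simp
  · rfl

/-- `Σ_{t<2^m, bit t of N} w(pt t) = pr q 𝒴` when the low bits of `N` describe `𝒴`. [this work] -/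
theorem sum_bit_mlM (q : Fin m → unitInterval) {N : ℕ} {𝒴 : Set (Set (Fin m))} (h : ∀ t, t < 2 ^ m → (N.testBit t = true ↔ pt m t ∈ 𝒴)) :
    ∑ t ∈ Finset.range (2 ^ m), (if N.testBit t = true then mlM m (2 ^ t) (xq q) else 0) = pr q 𝒴 := by
  rw [pr_eq_sum, sum_eq_sum_range]
  refine Finset.sum_congr rfl fun t ht => ?_
  have ht' := Finset.mem_range.1 ht
  rw [← bernoulliWeight_pt_eq_mlM q ht']
  by_cases hN : N.testBit t = true
  · rw [if_pos hN, ind_of_mem ((h t ht').1 hN), mul_one]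
  · rw [if_neg hN, ind_of_not_mem (fun hm => hN ((h t ht').2 hm)), mul_zero]

/-- Complement bits describe the complement event. [this work] -/
theorem cpl_spec {M : ℕ} {P : Set (Set (Fin m))} (hPM : ∀ x, x < 2 ^ m → (M.testBit x = true ↔ pt m x ∈ P)) :
    ∀ t, t < 2 ^ m → ((cpl m M).testBit t = true ↔ pt m t ∈ Pᶜ) := by
  intro t ht
  rw [testBit_cpl ht, Set.mem_compl_iff, ← hPM t ht]
  cases M.testBit t <;> simp

/-- **Total mass**: `Σ_T σ(T) = (1 − θ)·θ` (`θ = w(H)`), from the row sums of the table. [this work] -/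
theorem sum_sg {M : ℕ} {ct : Tab} {P : Set (Set (Fin m))} (hPM : ∀ x, x < 2 ^ m → (M.testBit x = true ↔ pt m x ∈ P))
    (hf : TabFacts m M ct) (q : Fin m → unitInterval) : ∑ T, sg m M ct q T = pr q Pᶜ * pr q P := by
  have h := sum_sg_mul_ind (m := m) M ct q Set.univ
  have hfull : ∀ t, t < 2 ^ m → (encA m (Set.univ : Set (Set (Fin m)))).testBit t = true := fun t ht => by
    rw [testBit_encA]; simp [ht]
  have hind : ∑ T, sg m M ct q T * ind (Set.univ : Set (Set (Fin m))) T = ∑ T, sg m M ct q T :=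
    Finset.sum_congr rfl fun T _ => by rw [ind_of_mem (Set.mem_univ T), mul_one]
  rw [hind] at h
  have h2 : (DEN : ℝ) * ∑ T, sg m M ct q T = (DEN : ℝ) *
      ((∑ η ∈ Finset.range (2 ^ m), if (cpl m M).testBit η = true then mlM m (2 ^ η) (xq q) else 0) *
        (∑ ζ ∈ Finset.range (2 ^ m), if M.testBit ζ = true then mlM m (2 ^ ζ) (xq q) else 0)) := by
    rw [h, Finset.sum_mul_sum, Finset.mul_sum]
    refine Finset.sum_congr rfl fun η hη => ?_
    rw [Finset.mul_sum]
    refine Finset.sum_congr rfl fun ζ hζ => ?_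
    have hη' := Finset.mem_range.1 hη
    rw [testBit_cpl hη']
    by_cases hc : M.testBit η = false ∧ M.testBit ζ = true
    · have hrow := hf.rowsum η hη' hc.1 ζ (Finset.mem_range.1 hζ) hc.2
      have hin : (∑ t ∈ Finset.range (2 ^ m), if (encA m (Set.univ : Set (Set (Fin m)))).testBit t = true then (get3 ct η ζ t : ℝ) else 0)
          = DEN := by
        rw [Finset.sum_congr rfl fun t ht => if_pos (hfull t (Finset.mem_range.1 ht))]
        exact_mod_cast hrow
      rw [if_pos hc, hin]
      simp [hc.1, hc.2]
    · rw [if_neg hc]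
      rcases not_and_or.1 hc with h1 | h1
      · have h1' : M.testBit η = true := by cases hb : M.testBit η <;> simp_all
        simp [h1']
      · simp [h1]
  have h3 := sum_bit_mlM q (cpl_spec hPM)
  have h4 := sum_bit_mlM q hPM
  rw [h3, h4] at h2
  exact mul_left_cancel₀ DEN_pos.ne' h2

/-! ### Part C: mass bounds, the stochastic-order condition, the row identities, and the certificate -/

/-- `massK` as an indicator sum. [this work] -/
theorem massK_eq_sum (M : ℕ) (ct : Tab) (K η ζ : ℕ) :
    massK m M ct K η ζ = ∑ t ∈ Finset.range (2 ^ m), if (M &&& K).testBit t = true then get3 ct η ζ t else 0 := by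
  unfold massK; rw [sum_pts]

/-- `0 ≤ massK ≤ DEN` on the relevant rows. [this work] -/
theorem massK_bounds {M : ℕ} {ct : Tab} (hf : TabFacts m M ct) (K : ℕ) {η ζ : ℕ} (hη : η < 2 ^ m) (hD : M.testBit η = false)
    (hζ : ζ < 2 ^ m) (hH : M.testBit ζ = true) : 0 ≤ massK m M ct K η ζ ∧ massK m M ct K η ζ ≤ DEN := by
  rw [massK_eq_sum, ← hf.rowsum η hη hD ζ hζ hH]
  constructor
  · exact Finset.sum_nonneg fun t ht => by
      split_ifs
      · exact hf.nonneg η hη hD ζ hζ hH t (Finset.mem_range.1 ht)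
      · exact le_rfl
  · exact Finset.sum_le_sum fun t ht => by
      split_ifs
      · exact le_rfl
      · exact hf.nonneg η hη hD ζ hζ hH t (Finset.mem_range.1 ht)

/-- For a relevant row, the `M`-bit in `massK` is redundant (the table is supported on `H`). [this work] -/
theorem massK_eq_sum' {M : ℕ} {ct : Tab} (hf : TabFacts m M ct) (K : ℕ) {η ζ : ℕ} (hη : η < 2 ^ m) (hD : M.testBit η = false)
    (hζ : ζ < 2 ^ m) (hH : M.testBit ζ = true) :
    massK m M ct K η ζ = ∑ t ∈ Finset.range (2 ^ m), if K.testBit t = true then get3 ct η ζ t else 0 := by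
  rw [massK_eq_sum]
  refine Finset.sum_congr rfl fun t ht => ?_
  rw [Nat.testBit_land]
  by_cases hK : K.testBit t = true
  · rw [hK, Bool.and_true, if_pos rfl]
    by_cases hM : M.testBit t = true
    · rw [if_pos hM]
    · rw [if_neg hM]
      by_contra hne
      exact hM (hf.supp η hη hD ζ hζ hH t (Finset.mem_range.1 ht) (Ne.symm hne)).2
  · rw [if_neg hK, Bool.eq_false_iff.2 hK, Bool.and_false]; simp

/-! #### The stochastic-order condition (o) from the support of the table -/

/-- `pt η ⊆ pt T` from `psub`. [this work] -/
theorem pt_subset_of_psub {η T : ℕ} (h : psub η T = true) : pt m η ⊆ pt m T :=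
  fun i hi => by simp only [pt, Set.mem_setOf_eq] at hi ⊢; exact psub_iff.1 h i hi

/-- **(o)**: `θ·w(Hᶜ ∩ 𝒯) ≤ Σ_T σ(T)·1_𝒯(T)` for every up-set `𝒯` — mass starting in `𝒯 ∖ H` stays in `𝒯`. [this work] -/
theorem stoch_of_tabFacts {M : ℕ} {ct : Tab} {P : Set (Set (Fin m))} (hPM : ∀ x, x < 2 ^ m → (M.testBit x = true ↔ pt m x ∈ P))
    (hf : TabFacts m M ct) (q : Fin m → unitInterval) {𝒯 : Set (Set (Fin m))} (h𝒯 : IsUpperSet 𝒯) :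
    pr q P * pr q (Pᶜ ∩ 𝒯) ≤ ∑ T, sg m M ct q T * ind 𝒯 T := by
  have hmain := sum_sg_mul_ind (m := m) M ct q 𝒯
  -- lower bound for the relevant inner sums
  have hinner : ∀ η, η < 2 ^ m → M.testBit η = false → (encA m 𝒯).testBit η = true → ∀ ζ, ζ < 2 ^ m → M.testBit ζ = true →
      (∑ t ∈ Finset.range (2 ^ m), if (encA m 𝒯).testBit t = true then (get3 ct η ζ t : ℝ) else 0) = DEN := by
    intro η hη hD hηT ζ hζ hH
    have hrow := hf.rowsum η hη hD ζ hζ hH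
    have : ∀ t ∈ Finset.range (2 ^ m), (if (encA m 𝒯).testBit t = true then (get3 ct η ζ t : ℝ) else 0) = (get3 ct η ζ t : ℝ) := by
      intro t ht
      by_cases hz : get3 ct η ζ t = 0
      · rw [hz]; simp
      · have hsub := (hf.supp η hη hD ζ hζ hH t (Finset.mem_range.1 ht) hz).1
        have hηT' : pt m η ∈ 𝒯 := by
          have := hηT; rw [testBit_encA] at this; simpa [hη] using this
        have htT : pt m t ∈ 𝒯 := h𝒯 (pt_subset_of_psub hsub) hηT'
        rw [if_pos (by rw [testBit_encA]; simp [Finset.mem_range.1 ht, htT])]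
    rw [Finset.sum_congr rfl this]; exact_mod_cast hrow
  have hlow : (DEN : ℝ) * (pr q P * pr q (Pᶜ ∩ 𝒯)) ≤ (DEN : ℝ) * ∑ T, sg m M ct q T * ind 𝒯 T := by
    rw [hmain]
    have hsplit : (DEN : ℝ) * (pr q P * pr q (Pᶜ ∩ 𝒯)) =
        ∑ η ∈ Finset.range (2 ^ m), ∑ ζ ∈ Finset.range (2 ^ m),
          if (cpl m M &&& encA m 𝒯).testBit η = true ∧ M.testBit ζ = true then (DEN : ℝ) * (mlM m (2 ^ η) (xq q) * mlM m (2 ^ ζ) (xq q)) else 0 := by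
      have h1 := sum_bit_mlM q hPM
      have h2 : ∀ t, t < 2 ^ m → ((cpl m M &&& encA m 𝒯).testBit t = true ↔ pt m t ∈ Pᶜ ∩ 𝒯) := by
        intro t ht
        rw [Nat.testBit_land, Bool.and_eq_true, cpl_spec hPM t ht, testBit_encA, Set.mem_inter_iff]
        simp [ht]
      have h3 := sum_bit_mlM q h2
      rw [← h1, ← h3, Finset.sum_mul_sum, Finset.sum_comm, Finset.mul_sum]
      refine Finset.sum_congr rfl fun η _ => ?_
      rw [Finset.mul_sum]
      refine Finset.sum_congr rfl fun ζ _ => ?_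
      by_cases ha : (cpl m M &&& encA m 𝒯).testBit η = true
      · by_cases hb : M.testBit ζ = true
        · rw [if_pos ha, if_pos hb, if_pos ⟨ha, hb⟩]; ring
        · rw [if_neg hb, if_neg (c := (cpl m M &&& encA m 𝒯).testBit η = true ∧ M.testBit ζ = true) (fun h => hb h.2)]; ring
      · rw [if_neg ha, if_neg (c := (cpl m M &&& encA m 𝒯).testBit η = true ∧ M.testBit ζ = true) (fun h => ha h.1)]; ring
    rw [hsplit]
    refine Finset.sum_le_sum fun η hη => Finset.sum_le_sum fun ζ hζ => ?_
    have hη' := Finset.mem_range.1 hη; have hζ' := Finset.mem_range.1 hζ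
    by_cases hc : M.testBit η = false ∧ M.testBit ζ = true
    · rw [if_pos hc]
      by_cases hηT : (encA m 𝒯).testBit η = true
      · rw [hinner η hη' hc.1 hηT ζ hζ' hc.2]
        split_ifs
        · exact le_rfl
        · exact mul_nonneg DEN_pos.le (mul_nonneg (mlM_nonneg _ (inCube_xq q)) (mlM_nonneg _ (inCube_xq q)))
      · have : ¬ ((cpl m M &&& encA m 𝒯).testBit η = true ∧ M.testBit ζ = true) := by
          rw [Nat.testBit_land, Bool.and_eq_true]; exact fun h => hηT h.1.2
        rw [if_neg this]
        exact mul_nonneg (Finset.sum_nonneg fun t ht => by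
          split_ifs
          · exact_mod_cast hf.nonneg η hη' hc.1 ζ hζ' hc.2 t (Finset.mem_range.1 ht)
          · exact le_rfl) (mul_nonneg (mlM_nonneg _ (inCube_xq q)) (mlM_nonneg _ (inCube_xq q)))
    · rw [if_neg hc]
      have : ¬ ((cpl m M &&& encA m 𝒯).testBit η = true ∧ M.testBit ζ = true) := by
        rw [Nat.testBit_land, Bool.and_eq_true, testBit_cpl hη']
        intro h
        apply hc
        refine ⟨?_, h.2⟩
        cases hb : M.testBit η
        · rfl
        · rw [hb] at h; exact absurd h.1.1 (by decide)
      rw [if_neg this]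
  exact le_of_mul_le_mul_left hlow DEN_pos


end Summit.CriticalPhenomena.PercolationContinuityZ3.Theorems.SahiTransportJR
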